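import Literature.NumberTheory.Automorphic.Liu2021.Def411WeilCarriersIrreducibleOfLocal
import Literature.NumberTheory.GelbartRogawski1991.FiniteAdelicWeilCentralCoinvariantsIrreducible
import Literature.GroupTheory.RestrictedProductCharacterFactors
import Literature.RepresentationTheory.TwistedCoinvariantsCentralCharacterQuotient
import HarnessLib

/-!
# [Liu2021, Def. 4.11]'s «irreducible» for the CONSTRUCTED `ω(μ, ε, χ)`, from Lem. D.1 (l. 5227) place by place and `⊗'`

Topic `NumberTheory/Automorphic/Liu2021`.  KERNEL ONLY: one definition with body (`localCharOfCenter`, the local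
components of a character of the centre) and theorems; no record, no named fact, no `sorry`.

This file closes the chain `IrreducibleTwistTransport` → `TwistedCoinvariantsIrreducible` →
`Def411WeilCarriersIrreducibleOfReference` → `UnitaryDualPairLocalReferenceSection` →
`Def411WeilCarriersIrreducibleOfLocal`
(«`hirr` ⟸ the `U(J_V)(𝔸_f)`-action on the maximal quotient of the place-assembled `Ω = ⊗'_v ω_v` where the centre acts by
`χ₁` is irreducible, for every continuous `χ₁`») with `FiniteAdelicWeilCentralCoinvariantsIrreducible` («that quotient is
`⊗'_v` of the local central quotients and is irreducible when they are irreducible admissible and the unramified vector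
survives», Flath) through the place-by-place centre of `UnitaryGroupFinAdelicCenterLocal`:

* `localCharOfCenter hJ₁ χ₁ v : U(J₁)(F_v) →* ℂˣ` — the local components `χ_{1,v}` of a character `χ₁` of `E¹(𝔸_{F,f})`
  (through `charOfCenter` and `RestrictedProduct.mulSingle`); for `χ₁` continuous, `χ₁ = ∏_v χ_{1,v}` and `χ_{1,v}` is
  unramified for almost all `v` (`GroupTheory/RestrictedProductCharacterFactors`);
* `WeilCoinv.omega_center_isIrreducible_of_local` — for a LINE `W` and local splittings `𝓢` of `U(J_{VW})`: IF every local
  central quotient `Coinv(ω_v ∘ (local centre), χ_{1,v})` is an irreducible admissible representation of `U(J_{VW})(F_v)`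
  ([Liu2021, App. D Lem. D.1, first sentence l. 5227] «`ω(μ, ε, χ)` is irreducible and admissible», local notation read
  at `v`) and the class of `1_{𝒪_vⁿ}` is non-zero
  off a finite `S₁` (Def. 4.11 «unramified for all but finitely many `v`»), THEN the `U(J_V)(𝔸_f)`-action on
  `Coinv(Ω ∘ (u ↦ u·1_n), χ₁)` is irreducible;
* **`Def411WeilCarriers.rho_isIrreducible_of_lemD1_local`** — hence, for `ι` onto and `s` compatible + continuous:
  **the END displays' `hirr` — `(rho … ι ε χ).IsIrreducible` — holds as soon as, at the line `a = lineOf ε`, local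
  splittings `𝓢` of `U(J_V ⊗ (a))(F_v)` (Liu's `ι_{μ_v}` for `V_{ε}`) are given for which, for every continuous character
  `χ₁` of `E¹(𝔸_{F,f})`, the local central quotients are irreducible admissible ([Liu2021, Lem. D.1, l. 5227] at
  `(μ_v, ε_v, χ_{1,v})`) and the unramified vector survives off a finite set.**
* `Def411WeilCarriers.rho_isIrreducible_of_irreducibleAdmissible_local` (`n ≥ 3`) — the same with the local input in
  the tree's Lem.-D.1 RECORD currency: `LocalOscillatorDatum.IrreducibleAdmissible` of the local datum
  `ofCentralChar (𝓢.omegaLoc v) (u ↦ u·1_n) _ χ_{1,v} n _` (the centre `U(J_W)(F_v)` is a `CommGroup` under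
  `open scoped IsMulCommutative`, instance `isMulCommutative_localPi_one`; conversion
  `WeilCoinv.twistedCoinv_isIrreducible_and_isAdmissible_of_irreducibleAdmissible` through
  `RepresentationTheory/TwistedCoinvariantsCentralCharacterQuotient`).

Nothing of [Liu2021] is asserted: the two local inputs are HYPOTHESES stated on the tree's local carriers
(`FinLocalSplittings.omegaLoc`, `localCenter`, `unitVec`).  HC_CM is not mentioned by this file.

## References
* [Liu2021] Y. Liu, Camb. J. Math. 9 (2021) = arXiv:2102.11518: Def. 4.11 (l. 2083–2097), App. D §D.1 Steps 1∕2∕3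
  (l. 5217∕5219∕5221), Lem. D.1 (l. 5227; (1) l. 5229 for non-vanishing).
* [Flath1979] D. Flath, PSPM 33 (1979) part 1, Thm. 2, Ex. 2.
* [TateThesis1967] J. Tate, in Cassels–Fröhlich (1967), §3.2 Lemma 3.2.1 (characters of restricted products).
* [GelbartRogawski1991] S. Gelbart, J. Rogawski, Invent. Math. 105 (1991), §3.1 Prop. 3.1.1 p. 455 L1–3.
-/

set_option autoImplicit false

noncomputable section

open scoped Matrix Kronecker TensorProduct Classical RestrictedProduct
open NumberField NumberField.mixedEmbedding IsDedekindDomain Filter Set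
open Literature.NumberTheory.Automorphic Literature.NumberTheory.Automorphic.UnitaryGroup
open Literature.NumberTheory.Weil1964 Literature.RepresentationTheory
open Literature.RepresentationTheory.HeisenbergGroup
open Literature.GroupTheory.RestrictedProductCharacter

/-! ## §1 Local components of a character of the centre -/

namespace Literature.NumberTheory.Automorphic.UnitaryGroup

variable (F E : Type) [Field F] [NumberField F] [Field E] [NumberField E] [Algebra F E]
variable (c : E ≃ₐ[F] E) (J₁ : Matrix (Fin 1) (Fin 1) E)

/-- **the local component `χ_{1,v} : U(J₁)(F_v) →* ℂˣ` of a character `χ₁` of the centre `E¹(𝔸_{F,f})`**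
(`charOfCenter χ₁` restricted to the `v`-th factor through Mathlib's `RestrictedProduct.mulSingle`).
[cite: TateThesis1967, §3.2 Lemma 3.2.1] -/
def localCharOfCenter (hJ₁ : J₁ 0 0 ≠ 0) (χ₁ : finAdelicOne F E c →* ℂˣ) (v : HeightOneSpectrum (𝓞 F)) :
    localPi E c 1 J₁ v →* ℂˣ where
  toFun x := charOfCenter F E c J₁ hJ₁ χ₁ (RestrictedProduct.mulSingle (fun v => localInt E c 1 J₁ v) v x)
  map_one' := by rw [RestrictedProduct.mulSingle_one, map_one]
  map_mul' x y := by rw [RestrictedProduct.mulSingle_mul, map_mul]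

/-- `χ_{1,v} x = charOfCenter χ₁ (mulSingle v x)`. [cite: TateThesis1967, §3.2 Lemma 3.2.1] -/
theorem localCharOfCenter_apply (hJ₁ : J₁ 0 0 ≠ 0) (χ₁ : finAdelicOne F E c →* ℂˣ) (v : HeightOneSpectrum (𝓞 F))
    (x : localPi E c 1 J₁ v) :
    localCharOfCenter F E c J₁ hJ₁ χ₁ v x =
      charOfCenter F E c J₁ hJ₁ χ₁ (RestrictedProduct.mulSingle (fun v => localInt E c 1 J₁ v) v x) := rfl

/-- **`χ₁ = ∏_v χ_{1,v}` on `Πʳ_v [U(J₁)(F_v), U(J₁)(𝒪_v)]`** for `χ₁` continuous. [cite: TateThesis1967, §3.2 Lemma 3.2.1] -/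
theorem coe_charOfCenter_eq_finprod (hJ₁ : J₁ 0 0 ≠ 0) {χ₁ : finAdelicOne F E c →* ℂˣ} (hχ₁ : Continuous χ₁)
    (g : Πʳ v : HeightOneSpectrum (𝓞 F), [localPi E c 1 J₁ v, localInt E c 1 J₁ v]) :
    ((charOfCenter F E c J₁ hJ₁ χ₁ g : ℂˣ) : ℂ) = ∏ᶠ v, ((localCharOfCenter F E c J₁ hJ₁ χ₁ v (g v) : ℂˣ) : ℂ) :=
  coe_apply_eq_finprod_of_local _ (continuous_charOfCenter F E c J₁ hJ₁ hχ₁) _ (fun _ _ => rfl) g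

/-- **`χ_{1,v}` is unramified for almost all `v`** (trivial on `U(J₁)(𝒪_v)`) for `χ₁` continuous. [cite: TateThesis1967, §3.2 Lemma 3.2.1] -/
theorem eventually_localCharOfCenter_eq_one (hJ₁ : J₁ 0 0 ≠ 0) {χ₁ : finAdelicOne F E c →* ℂˣ} (hχ₁ : Continuous χ₁) :
    ∀ᶠ v in cofinite, ∀ x ∈ localInt E c 1 J₁ v, localCharOfCenter F E c J₁ hJ₁ χ₁ v x = 1 :=
  eventually_forall_local_eq_one _ (continuous_charOfCenter F E c J₁ hJ₁ hχ₁) _ (fun _ _ => rfl)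

/-- `U(J₁)(F_v) ≤ Π_{w ∣ v} GL₁(E_w)` is commutative (`1 × 1` matrices over a field commute).  With
`open scoped IsMulCommutative` this makes `U(J₁)(F_v)` a `CommGroup` — the centre currency `Z` of
`LocalOscillatorDatum` ([Liu2021, App. D §D.1 Step 3]: the centre `E_v¹` of `U(V)(F_v)`).
[cite: Liu2021, App. D §D.1 Step 3 (l. 5221)] -/
instance isMulCommutative_localPi_one (v : HeightOneSpectrum (𝓞 F)) : IsMulCommutative (localPi E c 1 J₁ v) :=
  ⟨⟨fun a b => Subtype.ext <| funext fun w => Units.ext <| Matrix.ext fun i j => by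
    obtain rfl : i = 0 := Subsingleton.elim _ _
    obtain rfl : j = 0 := Subsingleton.elim _ _
    change ((a : LocalGLPi E 1 v) w * (b : LocalGLPi E 1 v) w).1 0 0 =
      ((b : LocalGLPi E 1 v) w * (a : LocalGLPi E 1 v) w).1 0 0
    rw [Units.val_mul, Units.val_mul, Matrix.mul_apply, Matrix.mul_apply, Fin.sum_univ_one, Fin.sum_univ_one,
      mul_comm]⟩⟩

/-- the local centre map `u ↦ u·1_N` lands in the centre of `U(J)(F_v)`. [cite: Liu2021, App. D §D.1 Step 3 (l. 5221)] -/
theorem localCenter_mem_center (N : ℕ) (J : Matrix (Fin N) (Fin N) E) (hJ₁ : J₁ 0 0 ≠ 0) (v : HeightOneSpectrum (𝓞 F))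
    (z : localPi E c 1 J₁ v) : localCenter E c N J J₁ hJ₁ v z ∈ Subgroup.center (localPi E c N J v) :=
  Subgroup.mem_center_iff.2 fun g => localCenter_comm E c N J J₁ hJ₁ v z g

end Literature.NumberTheory.Automorphic.UnitaryGroup

/-! ## §2 The central coinvariants of the place-assembled `Ω` on the pair are irreducible, from local inputs -/

namespace Literature.NumberTheory.GelbartRogawski1991.UnitaryDualPair.WeilCoinv

variable (F E : Type) [Field F] [NumberField F] [Field E] [NumberField E] [Algebra F E]
variable (c : E ≃ₐ[F] E) (N : ℕ) {n : ℕ} (e : Fin N × Fin 1 ≃ Fin n)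
variable (JV : Matrix (Fin N) (Fin N) E) (JW : Matrix (Fin 1) (Fin 1) E)
variable {TV : Matrix (Fin N) (Fin N) F} {TW : Matrix (Fin 1) (Fin 1) F}
variable [Algebra.IsQuadraticExtension F E] {δ : E} (hcδ : c δ = -δ) (hδ : δ ≠ 0) {d : F}
  (hd : δ * δ = algebraMap F E d) (hV : TV.IsSymm) (hW : TW.IsSymm)
  (hJV : JV = TV.map (algebraMap F E)) (hJW : JW = TW.map (algebraMap F E)) (hJW0 : JW 0 0 ≠ 0)
  (𝓢 : LocalSplitting.FinLocalSplittings F E c n hcδ hδ hd (gram F e TV TW) (isSymm_gram F e hV hW)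
    (reindex_kronecker_eq_gram_map F E e hJV hJW))

/-- the local Weil operators commute with the local centre (scalar matrices are central; `map_mul`).
[cite: Liu2021, App. D §D.1 Step 3 (l. 5221)] -/
theorem commute_omegaLoc_localCenter (v : HeightOneSpectrum (𝓞 F)) (g : localPi E c n (Matrix.reindex e e (JV ⊗ₖ JW)) v)
    (h : localPi E c 1 JW v) :
    Commute (𝓢.omegaLoc v g) ((show Representation ℂ (localPi E c 1 JW v) _ from
      (𝓢.omegaLoc v).comp (localCenter E c n (Matrix.reindex e e (JV ⊗ₖ JW)) JW hJW0 v)) h) :=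
  (show Commute g (localCenter E c n (Matrix.reindex e e (JV ⊗ₖ JW)) JW hJW0 v h) from
    localCenter_comm E c n (Matrix.reindex e e (JV ⊗ₖ JW)) JW hJW0 v h g).map (𝓢.omegaLoc v)

-- B30 margin (HB160 probe, B-p08 g6 2026-08-29): the STATEMENT alone elaborates in ≈161 k heartbeats (the source spelling
-- of `RestrictedProduct.mapAlongMonoidHom … (Eventually.of_forall …)`; proof ≈12 k) — inside the default 200 k but without
-- the 160 k margin, hence an honest ×2 budget on this declaration only.
set_option maxHeartbeats 400000 in
omit [Algebra.IsQuadraticExtension F E] in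
/-- `Πʳ(localCenter)` of the `v`-components of `u·1_1` is central in `Πʳ_v [U(J_{VW})(F_v), U(J_{VW})(𝒪_v)]` (it is the
image of the central `u·1_n` under `finAdelicEquiv`). [cite: Liu2021, App. D §D.1 Step 3 (l. 5221)] -/
theorem commute_mapAlong_localCenter
    (g : Πʳ v : HeightOneSpectrum (𝓞 F), [localPi E c n (Matrix.reindex e e (JV ⊗ₖ JW)) v,
      localInt E c n (Matrix.reindex e e (JV ⊗ₖ JW)) v]) (u : finAdelicOne F E c) :
    Commute g (RestrictedProduct.mapAlongMonoidHom (fun v => localPi E c 1 JW v)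
        (fun v => localPi E c n (Matrix.reindex e e (JV ⊗ₖ JW)) v) id Filter.tendsto_id
        (fun v => localCenter E c n (Matrix.reindex e e (JV ⊗ₖ JW)) JW hJW0 v)
        (Eventually.of_forall fun v => localCenter_mapsTo_localInt E c n (Matrix.reindex e e (JV ⊗ₖ JW)) JW hJW0 v)
        (finAdelicEquiv F E c 1 JW (finAdelicCenter F E c 1 JW u))) := by
  rw [← finAdelicEquiv_finAdelicCenter_eq_mapAlong F E c n (Matrix.reindex e e (JV ⊗ₖ JW)) JW hJW0 u]
  obtain ⟨g₀, rfl⟩ := (finAdelicEquiv F E c n (Matrix.reindex e e (JV ⊗ₖ JW))).surjective g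
  exact (show Commute g₀ (finAdelicCenter F E c n (Matrix.reindex e e (JV ⊗ₖ JW)) u) from
    (finAdelicCenter_mul_comm F E c n _ u g₀).symm).map (finAdelicEquiv F E c n (Matrix.reindex e e (JV ⊗ₖ JW)))

/-- **Same space `S`, same acting group `H`, same `G`-action; two presentations of the `H`-action and of the
character that agree pointwise** (`ρW' h v = ρW h v`, `χ' h = χ h`): irreducibility of the `G`-action on the
`χ`-coinvariants passes from one presentation to the other (the case `T = 1`, `e = a = 1`, `φ = id` of
`TwistedCoinv.isIrreducible_rep_iff_of_mapEquiv`; used below to avoid re-elaborating the restricted-product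
presentation of the centre). [cite: Bump1997, §4.2 (twisting a representation by a character)] -/
private theorem isIrreducible_rep_of_forall_apply_eq {G H S : Type*} [Group G] [Group H] [AddCommGroup S]
    [Module ℂ S] {ρW ρW' : Representation ℂ H S} {χ χ' : H →* ℂˣ} {ρV : Representation ℂ G S}
    {hc : ∀ (g : G) (h : H), Commute (ρV g) (ρW h)} {hc' : ∀ (g : G) (h : H), Commute (ρV g) (ρW' h)}
    (hirr : (TwistedCoinv.rep χ ρV hc).IsIrreducible) (hρ : ∀ (h : H) (v : S), ρW' h v = ρW h v)
    (hχ : ∀ h : H, χ' h = χ h) : (TwistedCoinv.rep χ' ρV hc').IsIrreducible :=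
  (TwistedCoinv.isIrreducible_rep_iff_of_mapEquiv ρW χ ρW' χ' ρV ρV hc hc' (LinearEquiv.refl ℂ S) (fun _ => 1)
    (fun h v => by rw [Units.val_one, one_smul]; exact hρ h v) (fun h => by rw [one_mul]; exact hχ h)
    (MonoidHom.id G) Function.surjective_id (fun _ => 1)
    (fun g v => by rw [Units.val_one, one_smul]; rfl)).1 hirr

/-- **The `U(J_V)(𝔸_f)`-action on `Coinv(Ω ∘ (u ↦ u·1_n), χ₁)` is irreducible, from local inputs** (line `W`, `χ₁`
continuous).  HYPOTHESES (the two printed local inputs of [Liu2021, Def. 4.11], on the tree's local carriers): `hirr`,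
`hadm` — every local central quotient `Coinv(ω_v ∘ (local centre), χ_{1,v})` with its `U(J_{VW})(F_v)`-action is an
irreducible admissible representation ([Liu2021, App. D Lem. D.1, first sentence l. 5227]); `hx₀N` —
`[1_{𝒪_vⁿ}] ≠ 0` off a finite `S₁` («unramified for all but finitely many `v`»).  PROOF: the centre is `Πʳ(localCenter)`
place by place (`finAdelicEquiv_finAdelicCenter_eq_mapAlong`), `χ₁ = ∏ χ_{1,v}` (`coe_charOfCenter_eq_finprod`), so
`FinLocalSplittings.omega_centralCoinv_isIrreducible` (⊗′ + Flath) gives irreducibility under the big group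
`U(J_{VW})(𝔸_f)`, which for a line is `U(J_V)(𝔸_f) ⊗ 1` (`finPairEmb_inl_surjective_of_line`).
[cite: Liu2021, Def. 4.11 (l. 2092–2096), App. D §D.1 Step 3 (l. 5221), Lem. D.1 (l. 5227; (1) l. 5229 for non-vanishing); Flath1979, Theorem 2 / Example 2] -/
theorem omega_center_isIrreducible_of_local {χ₁ : finAdelicOne F E c →* ℂˣ} (hχ₁ : Continuous χ₁)
    {S₁ : Finset (HeightOneSpectrum (𝓞 F))}
    (hx₀N : ∀ v ∉ S₁,
      TwistedCoinv.mk (show Representation ℂ (localPi E c 1 JW v) _ from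
          (𝓢.omegaLoc v).comp (localCenter E c n (Matrix.reindex e e (JV ⊗ₖ JW)) JW hJW0 v))
        (localCharOfCenter F E c JW hJW0 χ₁ v) (unitVec F (Fin n) v) ≠ 0)
    (hirr : ∀ v, (TwistedCoinv.rep (localCharOfCenter F E c JW hJW0 χ₁ v) (𝓢.omegaLoc v)
      (commute_omegaLoc_localCenter F E c N e JV JW hcδ hδ hd hV hW hJV hJW hJW0 𝓢 v)).IsIrreducible)
    (hadm : ∀ v, (TwistedCoinv.rep (localCharOfCenter F E c JW hJW0 χ₁ v) (𝓢.omegaLoc v)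
      (commute_omegaLoc_localCenter F E c N e JV JW hcδ hδ hd hV hW hJV hJW hJW0 𝓢 v)).IsAdmissible) :
    (TwistedCoinv.rep χ₁
      (show Representation ℂ (finAdelic F E c N JV) _ from
        𝓢.Omega.comp ((finPairEmb F E c N 1 e JV JW).comp (MonoidHom.inl _ _)))
      (commute_omega_finPairEmb_finAdelicCenter F E c N e JV JW hcδ hδ hd hV hW hJV hJW 𝓢)).IsIrreducible := by
  -- the place-by-place centre `φ` is integral, and `ζ : E¹(𝔸_f) ↠ Πʳ_v U(J_W)(F_v)` is onto
  have hφ : ∀ᶠ v in cofinite, MapsTo (localCenter E c n (Matrix.reindex e e (JV ⊗ₖ JW)) JW hJW0 v)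
      ((localInt E c 1 JW v : Subgroup (localPi E c 1 JW v)) : Set (localPi E c 1 JW v))
      ((localInt E c n (Matrix.reindex e e (JV ⊗ₖ JW)) v : Subgroup (localPi E c n (Matrix.reindex e e (JV ⊗ₖ JW)) v)) :
        Set (localPi E c n (Matrix.reindex e e (JV ⊗ₖ JW)) v)) :=
    Eventually.of_forall fun v => localCenter_mapsTo_localInt E c n (Matrix.reindex e e (JV ⊗ₖ JW)) JW hJW0 v
  have hζ := finAdelicEquiv_comp_finAdelicCenter_surjective F E c JW hJW0
  -- §A: ⊗′ + Flath under the big group, the centre acting through `ζ`; the `W`-action through `ζ` IS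
  -- `Ω ∘ (u ↦ u·1_n)` (`finAdelicEquiv_finAdelicCenter_eq_mapAlong`, read through `Ω = Ω_Π ∘ finAdelicEquiv`)
  have hA := 𝓢.omega_centralCoinv_isIrreducible (fun v => localCenter E c n (Matrix.reindex e e (JV ⊗ₖ JW)) JW hJW0 v) hφ
    (χloc := fun v => localCharOfCenter F E c JW hJW0 χ₁ v)
    (commute_omegaLoc_localCenter F E c N e JV JW hcδ hδ hd hV hW hJV hJW hJW0 𝓢)
    (fun g h' => by
      obtain ⟨u, rfl⟩ := hζ h'
      exact (commute_mapAlong_localCenter F E c N e JV JW hJW0 g u).map 𝓢.OmegaPi)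
    (charOfCenter F E c JW hJW0 χ₁) (coe_charOfCenter_eq_finprod F E c JW hJW0 hχ₁)
    (eventually_localCharOfCenter_eq_one F E c JW hJW0 hχ₁) hx₀N hirr hadm
    ((finAdelicEquiv F E c 1 JW).toMonoidHom.comp (finAdelicCenter F E c 1 JW)) hζ
    (fun g u => (commute_mapAlong_localCenter F E c N e JV JW hJW0
      (finAdelicEquiv F E c n (Matrix.reindex e e (JV ⊗ₖ JW)) g) u).map 𝓢.OmegaPi)
  -- §B1: `χ₁ ∘ ζ⁻¹ ∘ ζ = χ₁` and the two presentations of the centre agree pointwise: same coinvariant space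
  have hc₁ : ∀ (g : finAdelic F E c n (Matrix.reindex e e (JV ⊗ₖ JW))) (u : finAdelicOne F E c),
      Commute (𝓢.Omega g) ((show Representation ℂ (finAdelicOne F E c) _ from
        𝓢.Omega.comp (finAdelicCenter F E c n (Matrix.reindex e e (JV ⊗ₖ JW)))) u) := fun g u =>
    (show Commute g (finAdelicCenter F E c n (Matrix.reindex e e (JV ⊗ₖ JW)) u) from
      (finAdelicCenter_mul_comm F E c n _ u g).symm).map 𝓢.Omega
  have hB : (TwistedCoinv.rep χ₁ 𝓢.Omega hc₁).IsIrreducible := by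
    refine isIrreducible_rep_of_forall_apply_eq hA (fun u f => ?_) fun u => ?_
    · exact (𝓢.Omega_apply _ f).trans (congrArg (fun g => 𝓢.OmegaPi g f)
        (finAdelicEquiv_finAdelicCenter_eq_mapAlong F E c n (Matrix.reindex e e (JV ⊗ₖ JW)) JW hJW0 u))
    · exact (DFunLike.congr_fun (charOfCenter_comp F E c JW hJW0 χ₁) u).symm
  -- §B2: for a line, `U(J_{VW})(𝔸_f) = U(J_V)(𝔸_f) ⊗ 1`
  exact (TwistedCoinv.isIrreducible_rep_comp_iff_of_surjective _ χ₁ 𝓢.Omega hc₁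
    ((finPairEmb F E c N 1 e JV JW).comp (MonoidHom.inl _ _))
    (fun G => by
      obtain ⟨k, hk⟩ := finPairEmb_inl_surjective_of_line F E c N JV e JW hJW0 G
      exact ⟨k, hk⟩)
    (commute_omega_finPairEmb_finAdelicCenter F E c N e JV JW hcδ hδ hd hV hW hJV hJW 𝓢)).2 hB

open scoped IsMulCommutative in
/-- **[Liu2021, App. D Lem. D.1 (first sentence, l. 5227)]'s RECORD predicate ⇒ the local `TwistedCoinv` inputs.**
At a place `v`, for the tree's Lem.-D.1 datum `ofCentralChar ω_v (u ↦ u·1_n) _ χ_{1,v} n _` (`ω_v = 𝓢.omegaLoc v`, centre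
`U(J_W)(F_v) = E_v¹` embedded as scalars), `IrreducibleAdmissible` («`ω(μ, ε, χ)` is irreducible and admissible» (l. 5227, read at `v`),
non-zero as `n ≥ 3`) gives: the `U(J_{VW})(F_v)`-action on `Coinv(ω_v ∘ (u ↦ u·1_n), χ_{1,v})` is irreducible and admissible
(`LocalOscillatorDatum.irreducibleAdmissible_ofCentralChar_iff_twistedCoinv`).
[cite: Liu2021, App. D Lem. D.1 (l. 5227; (1) l. 5229 for non-vanishing), §D.1 Step 3 (l. 5221)] -/
theorem twistedCoinv_isIrreducible_and_isAdmissible_of_irreducibleAdmissible (hn : 3 ≤ n)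
    (v : HeightOneSpectrum (𝓞 F)) (χ₁v : localPi E c 1 JW v →* ℂˣ)
    (h : (Literature.RepresentationTheory.Liu2021.LocalOscillatorDatum.ofCentralChar (𝓢.omegaLoc v)
        (localCenter E c n (Matrix.reindex e e (JV ⊗ₖ JW)) JW hJW0 v)
        (localCenter_mem_center F E c JW n (Matrix.reindex e e (JV ⊗ₖ JW)) hJW0 v) χ₁v n
        (Nat.le_of_succ_le hn)).IrreducibleAdmissible) :
    (TwistedCoinv.rep χ₁v (𝓢.omegaLoc v)
        (commute_omegaLoc_localCenter F E c N e JV JW hcδ hδ hd hV hW hJV hJW hJW0 𝓢 v)).IsIrreducible ∧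
      (TwistedCoinv.rep χ₁v (𝓢.omegaLoc v)
        (commute_omegaLoc_localCenter F E c N e JV JW hcδ hδ hd hV hW hJV hJW hJW0 𝓢 v)).IsAdmissible := by
  have h' := (Literature.RepresentationTheory.Liu2021.LocalOscillatorDatum.irreducibleAdmissible_ofCentralChar_iff_twistedCoinv
    (𝓢.omegaLoc v) (localCenter E c n (Matrix.reindex e e (JV ⊗ₖ JW)) JW hJW0 v)
    (localCenter_mem_center F E c JW n (Matrix.reindex e e (JV ⊗ₖ JW)) hJW0 v) χ₁v n (Nat.le_of_succ_le hn)
    (commute_omegaLoc_localCenter F E c N e JV JW hcδ hδ hd hV hW hJV hJW hJW0 𝓢 v)).1 h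
  exact ⟨h'.2.1 (h'.2.2 (by omega)), h'.1⟩

end Literature.NumberTheory.GelbartRogawski1991.UnitaryDualPair.WeilCoinv

/-! ## §3 The END displays' `hirr` from Lem. D.1 (l. 5227) place by place -/

section Liu

open Literature.NumberTheory Literature.NumberTheory.Automorphic
open Literature.NumberTheory.GelbartRogawski1991 Literature.NumberTheory.GelbartRogawski1991.UnitaryDualPair
open Literature.NumberTheory.GelbartRogawski1991.UnitaryDualPair.WeilCoinv

namespace Literature.NumberTheory.Automorphic.Liu2021.Def411WeilCarriers

variable (F E : Type) [Field F] [NumberField F] [Field E] [NumberField E] [Algebra F E]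
variable (c : E ≃ₐ[F] E) (N : ℕ) {n : ℕ} (e : Fin N × Fin 1 ≃ Fin n)
variable (JV : Matrix (Fin N) (Fin N) E) {TV : Matrix (Fin N) (Fin N) F}
variable [Algebra.IsQuadraticExtension F E] {δ : E} (hcδ : c δ = -δ) (hδ : δ ≠ 0) {d : F}
  (hd : δ * δ = algebraMap F E d) (hV : TV.IsSymm) (hVd : IsUnit TV.det) (hJV : JV = TV.map (algebraMap F E))
variable {s : ∀ a : Fˣ, UnitaryGroup.adelicPair F E c N 1 JV (JW F E a) →* adelicMpCont F (Fin n) (adelicGram F e TV (TW F a))}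
  (hs : ∀ a : Fˣ, (splittingDatum F E c N 1 e JV (JW F E a) hcδ hδ hd hV (isSymm_TW F a) hVd (isUnit_det_TW F a) hJV
    (JW_eq F E a)).IsCompatible (s a))
  (hsc : ∀ a : Fˣ, Continuous (pairSplitting F E c N 1 e JV (JW F E a) (s a)))
variable (ε : Eps F d) (χ : Chi F E c)
variable (𝓢 : LocalSplitting.FinLocalSplittings F E c n hcδ hδ hd (gram F e TV (TW F (lineOf F d ε)))
    (isSymm_gram F e hV (isSymm_TW F (lineOf F d ε)))
    (reindex_kronecker_eq_gram_map F E e hJV (JW_eq F E (lineOf F d ε))))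
variable {G : Type*} [Group G] [TopologicalSpace G] {ι : G →* UnitaryGroup.finAdelic F E c N JV}
  (hι : Function.Surjective ι)

omit [TopologicalSpace G] in
include hsc hι in
/-- **[Liu2021, Def. 4.11]'s «irreducible» for the constructed `ω(μ, ε, χ)` — the END displays' `hirr` — from
Lem. D.1 (l. 5227) PLACE BY PLACE.**  Let `s` be a compatible continuous splitting family of the pair data `(V, ⟨a⟩)`, `ι` onto,
and, at `a = lineOf ε`, let `𝓢` be local splittings of `U(J_V ⊗ (a))(F_v)` (Liu's `ι_{μ_v}`; displayed DATA).  IF for every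
continuous character `χ₁` of the centre `E¹(𝔸_{F,f})`: (i) every local central quotient of `ω_v = ω(ε_v) ∘ ι_{μ_v}` at
`χ_{1,v}` is an irreducible admissible representation of `U(J_V ⊗ (a))(F_v)` — [Liu2021, App. D Lem. D.1, first sentence
l. 5227] «`ω(μ, ε, χ)` is irreducible and admissible» (App. D's local notation, read at `v`) —, and (ii) the class of the
unramified vector `1_{𝒪_vⁿ}` is non-zero for all `v` off a finite set — Def. 4.11's `⊗'` «unramified for all but
finitely many `v`» —, THEN `rho … ι ε χ` is irreducible.
[cite: Liu2021, Def. 4.11 (l. 2092–2096), App. D §D.1 Steps 1∕2∕3 (l. 5217∕5219∕5221), Lem. D.1 (l. 5227; (1) l. 5229 for non-vanishing); Flath1979, Theorem 2 / Example 2] -/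
theorem rho_isIrreducible_of_lemD1_local
    (hloc : ∀ χ₁ : UnitaryGroup.finAdelicOne F E c →* ℂˣ, Continuous χ₁ →
      (∀ v, (TwistedCoinv.rep (localCharOfCenter F E c (JW F E (lineOf F d ε)) (JW_apply_ne_zero F E _) χ₁ v)
            (𝓢.omegaLoc v)
            (commute_omegaLoc_localCenter F E c N e JV (JW F E (lineOf F d ε)) hcδ hδ hd hV (isSymm_TW F _) hJV
              (JW_eq F E _) (JW_apply_ne_zero F E _) 𝓢 v)).IsIrreducible ∧
          (TwistedCoinv.rep (localCharOfCenter F E c (JW F E (lineOf F d ε)) (JW_apply_ne_zero F E _) χ₁ v)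
            (𝓢.omegaLoc v)
            (commute_omegaLoc_localCenter F E c N e JV (JW F E (lineOf F d ε)) hcδ hδ hd hV (isSymm_TW F _) hJV
              (JW_eq F E _) (JW_apply_ne_zero F E _) 𝓢 v)).IsAdmissible) ∧
      ∃ S₁ : Finset (HeightOneSpectrum (𝓞 F)), ∀ v ∉ S₁,
        TwistedCoinv.mk (show Representation ℂ (UnitaryGroup.localPi E c 1 (JW F E (lineOf F d ε)) v) _ from
            (𝓢.omegaLoc v).comp (localCenter E c n (Matrix.reindex e e (JV ⊗ₖ JW F E (lineOf F d ε))) (JW F E (lineOf F d ε))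
              (JW_apply_ne_zero F E _) v))
          (localCharOfCenter F E c (JW F E (lineOf F d ε)) (JW_apply_ne_zero F E _) χ₁ v) (unitVec F (Fin n) v) ≠ 0) :
    (rho F E c N e JV hcδ hδ hd hV hVd hJV hs ι ε χ).IsIrreducible :=
  rho_isIrreducible_of_omega_center F E c N e JV hcδ hδ hd hV hVd hJV hs hsc ε χ 𝓢 hι fun χ₁ hχ₁ => by
    obtain ⟨h1, S₁, hS⟩ := hloc χ₁ hχ₁
    exact omega_center_isIrreducible_of_local F E c N e JV (JW F E (lineOf F d ε)) hcδ hδ hd hV (isSymm_TW F _) hJV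
      (JW_eq F E _) (JW_apply_ne_zero F E _) 𝓢 hχ₁ hS (fun v => (h1 v).1) (fun v => (h1 v).2)

open scoped IsMulCommutative in
omit [TopologicalSpace G] in
include hsc hι in
/-- **The END displays' `hirr` from [Liu2021, App. D Lem. D.1 (l. 5227)] cited in the tree's RECORD currency, place by place**
(`n ≥ 3`).  As `rho_isIrreducible_of_lemD1_local`, with hypothesis (i) replaced by the Lem.-D.1 record predicate
`LocalOscillatorDatum.IrreducibleAdmissible` of the local datum `ofCentralChar (𝓢.omegaLoc v) (u ↦ u·1_n) _ χ_{1,v} n _`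
(what `LemD1_1AsPrinted.irreducibleAdmissible` delivers for a local model presented on these carriers); (ii) is
Def. 4.11's `⊗'` clause «unramified for all but finitely many `v`» (the class of `1_{𝒪_vⁿ}` is non-zero off a finite set).
[cite: Liu2021, Def. 4.11 (l. 2092–2096), App. D §D.1 Steps 1∕2∕3 (l. 5217∕5219∕5221), Lem. D.1 (l. 5227; (1) l. 5229 for non-vanishing); Flath1979, Theorem 2 / Example 2] -/
theorem rho_isIrreducible_of_irreducibleAdmissible_local (hn : 3 ≤ n)
    (hD1 : ∀ χ₁ : UnitaryGroup.finAdelicOne F E c →* ℂˣ, Continuous χ₁ →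
      (∀ v, (Literature.RepresentationTheory.Liu2021.LocalOscillatorDatum.ofCentralChar (𝓢.omegaLoc v)
          (localCenter E c n (Matrix.reindex e e (JV ⊗ₖ JW F E (lineOf F d ε))) (JW F E (lineOf F d ε))
            (JW_apply_ne_zero F E _) v)
          (localCenter_mem_center F E c (JW F E (lineOf F d ε)) n (Matrix.reindex e e (JV ⊗ₖ JW F E (lineOf F d ε)))
            (JW_apply_ne_zero F E _) v)
          (localCharOfCenter F E c (JW F E (lineOf F d ε)) (JW_apply_ne_zero F E _) χ₁ v) n
          (Nat.le_of_succ_le hn)).IrreducibleAdmissible) ∧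
      ∃ S₁ : Finset (HeightOneSpectrum (𝓞 F)), ∀ v ∉ S₁,
        TwistedCoinv.mk (show Representation ℂ (UnitaryGroup.localPi E c 1 (JW F E (lineOf F d ε)) v) _ from
            (𝓢.omegaLoc v).comp (localCenter E c n (Matrix.reindex e e (JV ⊗ₖ JW F E (lineOf F d ε))) (JW F E (lineOf F d ε))
              (JW_apply_ne_zero F E _) v))
          (localCharOfCenter F E c (JW F E (lineOf F d ε)) (JW_apply_ne_zero F E _) χ₁ v) (unitVec F (Fin n) v) ≠ 0) :
    (rho F E c N e JV hcδ hδ hd hV hVd hJV hs ι ε χ).IsIrreducible :=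
  rho_isIrreducible_of_lemD1_local F E c N e JV hcδ hδ hd hV hVd hJV hs hsc ε χ 𝓢 hι fun χ₁ hχ₁ => by
    obtain ⟨h1, hS⟩ := hD1 χ₁ hχ₁
    exact ⟨fun v => twistedCoinv_isIrreducible_and_isAdmissible_of_irreducibleAdmissible F E c N e JV
      (JW F E (lineOf F d ε)) hcδ hδ hd hV (isSymm_TW F _) hJV (JW_eq F E _) (JW_apply_ne_zero F E _) 𝓢 hn v _ (h1 v), hS⟩

end Literature.NumberTheory.Automorphic.Liu2021.Def411WeilCarriers

end Liu

end
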